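import Mathlib
import HarnessLib
import Literature.Probability.LatticeModels.SampledSymbolDifferences

/-!
# Route `KLProgramme` — engine support, route (L2) symbol layer (b₃): POINTWISE differences of a sampled space-time symbol on
# `(ℤ/Pℤ)¹ × (ℤ/Lℤ)²` are differences of the continuum symbol along real lines, hence bounded by line derivatives

Cell `gate-hubbard-kl`, seat p4 (C5a lead), g6; the pointwise twin of `Literature/Probability/LatticeModels/SampledSymbolDifferences.lean`
(which bounds the `ℓ¹` SUMS `Σ_p ‖Δᴺ G(p)‖`).  The master lemma of the additive `ℓ²` route
(`KLProgrammeKLRegimeTorusL1SecondDifferences.sum_norm_charSum_le_of_second_differences`, k3c2-p3) consumes POINTWISE bounds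
`‖Δ²_w G(p)‖ ≤ A₀(4/(s_w P_w))²` of the sampled symbol `G(i, k⃗) = Φ(a₀ + h₀ i, hₓ k̃)` (`a₀ + h₀ i = π(2(i−M)+1)/β`, plain section `val`
in time; `hₓ k̃ = 2πk̃/L`, centred section `valMinAbs` in space).  Here, for a continuum symbol `Φ : ℝ × ℝ² → E` vanishing near the seams
(frequency window well inside the kept frequencies; momenta well inside the zone):

* **`fwdDiff_iter_time_apply_eq`** — `(Δ_{(1,0)}ᴺ G)(p) = (Δ_{(h₀,0)}ᴺ Φ)(k(p))` at the sample point `k(p)`;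
* **`fwdDiff_iter_space_apply_eq`** — `(Δ_{(0,ū)}ᴺ G)(p) = (Δ_{(0,hₓu)}ᴺ Φ)(k(p))` for an integer step `u`;
* **`norm_fwdDiff_iter_time_apply_le`**, **`norm_fwdDiff_iter_space_apply_le`** — hence `‖Δᴺ G(p)‖ ≤ K(p)` for every bound `K(p)` of the
  `N`-th derivative of `Φ` along the segment `s ∈ [0, N]` of the real line through `k(p)` with step `(h₀, 0)` resp. `(0, hₓu)`
  (`IteratedDifferenceDerivBound.norm_fwdDiff_iter_apply_le_of_line`) — a POINTWISE bound, so that the symbol layer may use the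
  anisotropic (base-point dependent) line bounds of `…SymbolLineDerivTwo`.

Everything is proved; no definitions, no named facts. [folklore]  (Benfatto–Giuliani–Mastropietro 2006, Lemma 2.2, (2.36aa) and footnote ¹.)
-/

noncomputable section

namespace Summit.HubbardSuperconductivity.HubbardSuperconductivity.Theorems.TorusFourierL2

set_option linter.dupNamespace false -- summit = problem name (single-conjunct summit), D-0017

open Finset Literature.Probability.LatticeModels Literature.Analysis.Calculus

variable {P L : ℕ} [NeZero P] [NeZero L] {E : Type*} [NormedAddCommGroup E] [NormedSpace ℝ E]

/-! ### Time differences -/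

omit [NeZero L] [NormedSpace ℝ E] in
/-- **Time differences of a sampled symbol, pointwise**: with `G(p) = Φ(a₀ + h₀ val(p₁), hₓ p̃₂)` and `Φ(a₀ + h₀ m, ·) = 0` for the
integers `m < N` and `m ≥ P − N`, `(Δ_{(1,0)}ᴺ G)(p) = (Δ_{(h₀,0)}ᴺ Φ)(a₀ + h₀ val(p₁), hₓ p̃₂)`. [cite: BenfattoGiulianiMastropietro2006, (2.36aa)] -/
theorem fwdDiff_iter_time_apply_eq (Φ : ℝ × (Fin 2 → ℝ) → E) (a₀ h₀ hx : ℝ) (N : ℕ) (G : TorusSite 1 P × TorusSite 2 L → E)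
    (hG : ∀ p, G p = Φ (a₀ + h₀ * (((p.1 0).val : ℕ) : ℝ), fun j => hx * (((p.2 j).valMinAbs : ℤ) : ℝ)))
    (hsupp : ∀ (m : ℤ) (k : Fin 2 → ℝ), (m < N ∨ (P : ℤ) ≤ m + N) → Φ (a₀ + h₀ * (m : ℝ), k) = 0)
    (p : TorusSite 1 P × TorusSite 2 L) :
    ((fwdDiff ((fun _ : Fin 1 => (1 : ZMod P)), (0 : TorusSite 2 L)))^[N] G) p =
      ((fwdDiff (((h₀, 0) : ℝ × (Fin 2 → ℝ))))^[N] Φ)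
        (a₀ + h₀ * (((p.1 0).val : ℕ) : ℝ), fun j => hx * (((p.2 j).valMinAbs : ℤ) : ℝ)) := by
  classical
  obtain ⟨φ, hφ⟩ := exists_timeSamplingHom (h₀ := h₀)
  -- the partial function at the fixed spatial momentum, as a sampled function on `ℤ¹`
  let f : (Fin 1 → ℤ) → E := fun m => Φ (((a₀, fun j => hx * (((p.2 j).valMinAbs : ℤ) : ℝ)) : ℝ × (Fin 2 → ℝ)) + φ m)
  have hf : ∀ m, f m = Φ (((a₀, fun j => hx * (((p.2 j).valMinAbs : ℤ) : ℝ)) : ℝ × (Fin 2 → ℝ)) + φ m) := fun _ => rfl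
  have hfG : ∀ b : TorusSite 1 P, f (fun j => ((b j).val : ℤ)) = G (b, p.2) := by
    intro b
    rw [hf, hφ, hG]
    simp
  have hfun : (fun b : TorusSite 1 P => G (b, p.2)) = fun b => f (fun j => ((b j).val : ℤ)) := funext fun b => (hfG b).symm
  -- consistency of the plain section
  have hcons : ∀ (a : TorusSite 1 P) (t : ℕ), t ≤ N →
      f (fun j => ((a j).val : ℤ) + t * (fun _ : Fin 1 => (1 : ℤ)) j) =
        f (fun j => (((a j + (t : ZMod P) * ((fun _ : Fin 1 => (1 : ℤ)) j : ZMod P)).val : ℕ) : ℤ)) := by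
    intro a t ht
    refine section_consistent_val (P := P) f (fun _ : Fin 1 => (1 : ℤ)) N (fun m hm => ?_) a t ht
    obtain ⟨j, hj⟩ := hm
    have hj0 : m 0 < N ∨ (P : ℤ) ≤ m 0 + N := by
      have hj' : j = 0 := Subsingleton.elim _ _
      subst hj'
      simpa using hj
    rw [hf, hφ]
    simp only [Prod.mk_add_mk, add_zero]
    exact hsupp (m 0) _ hj0
  have hstep1 : ((fun _ : Fin 1 => (1 : ZMod P)) : TorusSite 1 P) = fun j => (((fun _ : Fin 1 => (1 : ℤ)) j : ℤ) : ZMod P) := by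
    funext j; simp
  rw [fwdDiff_iter_prod_fst, hfun, hstep1,
    fwdDiff_iter_comp_section (fun a : ZMod P => (a.val : ℤ)) f (fun _ : Fin 1 => (1 : ℤ)) N hcons p.1]
  have hcomp : ((fwdDiff (fun _ : Fin 1 => (1 : ℤ)))^[N] f) (fun j => ((p.1 j).val : ℤ)) =
      ((fwdDiff (φ fun _ : Fin 1 => (1 : ℤ)))^[N] Φ)
        (((a₀, fun j => hx * (((p.2 j).valMinAbs : ℤ) : ℝ)) : ℝ × (Fin 2 → ℝ)) + φ fun j => ((p.1 j).val : ℤ)) :=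
    fwdDiff_iter_comp_addMonoidHom φ _ Φ _ N _
  rw [hcomp]
  have hstep : φ (fun _ : Fin 1 => (1 : ℤ)) = ((h₀, 0) : ℝ × (Fin 2 → ℝ)) := by rw [hφ]; simp
  have hbase : (((a₀, fun j => hx * (((p.2 j).valMinAbs : ℤ) : ℝ)) : ℝ × (Fin 2 → ℝ)) + φ fun j => ((p.1 j).val : ℤ)) =
      (a₀ + h₀ * (((p.1 0).val : ℕ) : ℝ), fun j => hx * (((p.2 j).valMinAbs : ℤ) : ℝ)) := by
    rw [hφ]
    simp
  rw [hstep, hbase]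

omit [NeZero L] in
/-- **Pointwise bound of the time differences by a line derivative**: under the hypotheses of `fwdDiff_iter_time_apply_eq`, if the
restriction of `Φ` to the real line through the sample point `k(p)` with step `(h₀, 0)` is `Cᴺ` with `N`-th derivative bounded by `K` on
`s ∈ [0, N]`, then `‖(Δ_{(1,0)}ᴺ G)(p)‖ ≤ K`. [cite: BenfattoGiulianiMastropietro2006, (2.36aa)] -/
theorem norm_fwdDiff_iter_time_apply_le (Φ : ℝ × (Fin 2 → ℝ) → E) (a₀ h₀ hx : ℝ) (N : ℕ) (G : TorusSite 1 P × TorusSite 2 L → E)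
    (hG : ∀ p, G p = Φ (a₀ + h₀ * (((p.1 0).val : ℕ) : ℝ), fun j => hx * (((p.2 j).valMinAbs : ℤ) : ℝ)))
    (hsupp : ∀ (m : ℤ) (k : Fin 2 → ℝ), (m < N ∨ (P : ℤ) ≤ m + N) → Φ (a₀ + h₀ * (m : ℝ), k) = 0)
    (p : TorusSite 1 P × TorusSite 2 L) {K : ℝ}
    (hC : ContDiff ℝ N fun s : ℝ =>
      Φ (((a₀ + h₀ * (((p.1 0).val : ℕ) : ℝ), fun j => hx * (((p.2 j).valMinAbs : ℤ) : ℝ)) : ℝ × (Fin 2 → ℝ)) +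
        s • ((h₀, 0) : ℝ × (Fin 2 → ℝ))))
    (hK : ∀ s ∈ Set.Icc (0 : ℝ) N, ‖iteratedDeriv N (fun s : ℝ =>
      Φ (((a₀ + h₀ * (((p.1 0).val : ℕ) : ℝ), fun j => hx * (((p.2 j).valMinAbs : ℤ) : ℝ)) : ℝ × (Fin 2 → ℝ)) +
        s • ((h₀, 0) : ℝ × (Fin 2 → ℝ)))) s‖ ≤ K) :
    ‖((fwdDiff ((fun _ : Fin 1 => (1 : ZMod P)), (0 : TorusSite 2 L)))^[N] G) p‖ ≤ K := by
  rw [fwdDiff_iter_time_apply_eq Φ a₀ h₀ hx N G hG hsupp p]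
  exact norm_fwdDiff_iter_apply_le_of_line _ _ N Φ hC hK

/-! ### Space differences -/

omit [NormedSpace ℝ E] in
/-- **Space differences of a sampled symbol, pointwise**: with `G` as above, an integer step `u`, and `Φ(·, hₓ m) = 0` whenever
`2|m_j| + 2N|u_j| ≥ L` for some `j`, `(Δ_{(0,ū)}ᴺ G)(p) = (Δ_{(0,hₓu)}ᴺ Φ)(a₀ + h₀ val(p₁), hₓ p̃₂)`. [cite: BenfattoGiulianiMastropietro2006, (2.36aa)] -/
theorem fwdDiff_iter_space_apply_eq (Φ : ℝ × (Fin 2 → ℝ) → E) (a₀ h₀ hx : ℝ) (N : ℕ) (G : TorusSite 1 P × TorusSite 2 L → E)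
    (hG : ∀ p, G p = Φ (a₀ + h₀ * (((p.1 0).val : ℕ) : ℝ), fun j => hx * (((p.2 j).valMinAbs : ℤ) : ℝ)))
    (u : Fin 2 → ℤ)
    (hsupp : ∀ (k₀ : ℝ) (m : Fin 2 → ℤ), (∃ j, (L : ℤ) ≤ 2 * |m j| + 2 * N * |u j|) → Φ (k₀, fun j => hx * (m j : ℝ)) = 0)
    (p : TorusSite 1 P × TorusSite 2 L) :
    ((fwdDiff ((0 : TorusSite 1 P), (fun j => ((u j : ℤ) : ZMod L))))^[N] G) p =
      ((fwdDiff (((0 : ℝ), fun j => hx * (u j : ℝ)) : ℝ × (Fin 2 → ℝ)))^[N] Φ)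
        (a₀ + h₀ * (((p.1 0).val : ℕ) : ℝ), fun j => hx * (((p.2 j).valMinAbs : ℤ) : ℝ)) := by
  classical
  obtain ⟨φ, hφ⟩ := exists_spaceSamplingHom (hx := hx)
  let f : (Fin 2 → ℤ) → E := fun m => Φ (((a₀ + h₀ * (((p.1 0).val : ℕ) : ℝ), 0) : ℝ × (Fin 2 → ℝ)) + φ m)
  have hf : ∀ m, f m = Φ (((a₀ + h₀ * (((p.1 0).val : ℕ) : ℝ), 0) : ℝ × (Fin 2 → ℝ)) + φ m) := fun _ => rfl
  have hfG : ∀ k : TorusSite 2 L, f (fun j => (k j).valMinAbs) = G (p.1, k) := by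
    intro k
    rw [hf, hφ, hG]
    simp
  have hfun : (fun k : TorusSite 2 L => G (p.1, k)) = fun k => f (fun j => (k j).valMinAbs) := funext fun k => (hfG k).symm
  have hcons : ∀ (a : TorusSite 2 L) (t : ℕ), t ≤ N →
      f (fun j => (a j).valMinAbs + t * u j) = f (fun j => (a j + (t : ZMod L) * (u j : ZMod L)).valMinAbs) := by
    intro a t ht
    refine section_consistent_valMinAbs (P := L) f u N (fun m hm => ?_) a t ht
    rw [hf, hφ]
    simp only [Prod.mk_add_mk, add_zero, zero_add]
    exact hsupp _ m hm
  rw [fwdDiff_iter_prod_snd, hfun, fwdDiff_iter_comp_section (fun a : ZMod L => a.valMinAbs) f u N hcons p.2]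
  have hcomp : ((fwdDiff u)^[N] f) (fun j => (p.2 j).valMinAbs) =
      ((fwdDiff (φ u))^[N] Φ) ((((a₀ + h₀ * (((p.1 0).val : ℕ) : ℝ), 0)) : ℝ × (Fin 2 → ℝ)) + φ fun j => (p.2 j).valMinAbs) :=
    fwdDiff_iter_comp_addMonoidHom φ _ Φ _ N _
  rw [hcomp, hφ u]
  have hbase : ((((a₀ + h₀ * (((p.1 0).val : ℕ) : ℝ), 0)) : ℝ × (Fin 2 → ℝ)) + φ fun j => (p.2 j).valMinAbs) =
      (a₀ + h₀ * (((p.1 0).val : ℕ) : ℝ), fun j => hx * (((p.2 j).valMinAbs : ℤ) : ℝ)) := by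
    rw [hφ]
    simp
  rw [hbase]

/-- **Pointwise bound of the space differences by a line derivative**: under the hypotheses of `fwdDiff_iter_space_apply_eq`, if the
restriction of `Φ` to the real line through `k(p)` with step `(0, hₓu)` is `Cᴺ` with `N`-th derivative `≤ K` on `[0, N]`, then
`‖(Δ_{(0,ū)}ᴺ G)(p)‖ ≤ K`. [cite: BenfattoGiulianiMastropietro2006, (2.36aa)] -/
theorem norm_fwdDiff_iter_space_apply_le (Φ : ℝ × (Fin 2 → ℝ) → E) (a₀ h₀ hx : ℝ) (N : ℕ) (G : TorusSite 1 P × TorusSite 2 L → E)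
    (hG : ∀ p, G p = Φ (a₀ + h₀ * (((p.1 0).val : ℕ) : ℝ), fun j => hx * (((p.2 j).valMinAbs : ℤ) : ℝ)))
    (u : Fin 2 → ℤ)
    (hsupp : ∀ (k₀ : ℝ) (m : Fin 2 → ℤ), (∃ j, (L : ℤ) ≤ 2 * |m j| + 2 * N * |u j|) → Φ (k₀, fun j => hx * (m j : ℝ)) = 0)
    (p : TorusSite 1 P × TorusSite 2 L) {K : ℝ}
    (hC : ContDiff ℝ N fun s : ℝ =>
      Φ (((a₀ + h₀ * (((p.1 0).val : ℕ) : ℝ), fun j => hx * (((p.2 j).valMinAbs : ℤ) : ℝ)) : ℝ × (Fin 2 → ℝ)) +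
        s • (((0 : ℝ), fun j => hx * (u j : ℝ)) : ℝ × (Fin 2 → ℝ))))
    (hK : ∀ s ∈ Set.Icc (0 : ℝ) N, ‖iteratedDeriv N (fun s : ℝ =>
      Φ (((a₀ + h₀ * (((p.1 0).val : ℕ) : ℝ), fun j => hx * (((p.2 j).valMinAbs : ℤ) : ℝ)) : ℝ × (Fin 2 → ℝ)) +
        s • (((0 : ℝ), fun j => hx * (u j : ℝ)) : ℝ × (Fin 2 → ℝ)))) s‖ ≤ K) :
    ‖((fwdDiff ((0 : TorusSite 1 P), (fun j => ((u j : ℤ) : ZMod L))))^[N] G) p‖ ≤ K := by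
  rw [fwdDiff_iter_space_apply_eq Φ a₀ h₀ hx N G hG u hsupp p]
  exact norm_fwdDiff_iter_apply_le_of_line _ _ N Φ hC hK

/-! ### The line through the sample point, in product coordinates -/

/-- Along the time step the line through `k = (k₀, k⃗)` is `s ↦ (k₀ + s h₀, k⃗)`. [folklore] -/
theorem timeLine_apply (k₀ : ℝ) (k : Fin 2 → ℝ) (h₀ s : ℝ) :
    ((k₀, k) : ℝ × (Fin 2 → ℝ)) + s • ((h₀, 0) : ℝ × (Fin 2 → ℝ)) = (k₀ + s * h₀, k) := by
  ext <;> simp [mul_comm]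

/-- Along a space step the line through `k = (k₀, k⃗)` is `s ↦ (k₀, k⃗ + s•w)`. [folklore] -/
theorem spaceLine_apply (k₀ : ℝ) (k w : Fin 2 → ℝ) (s : ℝ) :
    ((k₀, k) : ℝ × (Fin 2 → ℝ)) + s • (((0 : ℝ), w) : ℝ × (Fin 2 → ℝ)) = (k₀, k + s • w) := by
  ext <;> simp

end Summit.HubbardSuperconductivity.HubbardSuperconductivity.Theorems.TorusFourierL2

end
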